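import Mathlib
import Summits.NavierStokesRegularity.NavierStokesRegularity.Theorems.FilamentSkeletonRssClause13TaylorRemainderKernel
import Summits.NavierStokesRegularity.NavierStokesRegularity.Theorems.FilamentSkeletonRssClause13SmoothingKernelMoment

/-!
# Clause 13-R, MODEL level: AFFINE FIELDS ANNIHILATE THE STRAIGHT SELF-INDUCTION OPERATOR IN THE PAIRING —
# `∫ (a + bτ)·M_q[f](τ) dτ = 0` for compactly supported `f` (the exact affine annihilator of STUB R's mechanism)

Route `FilamentSkeletonRss`, crux `Clause13RNearStraightL` (stmt-NavierStokesRegularity-23612), line `rate_bordered_split`, STUB R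
`stub_rateRow13RFlat` (the RATE ROW).  The line card's mechanism for the rate row (memo `CENSUS-23610-side-23612-g16.md` §3 (m5)): pair the
bordered defect `DT·Y − dα·R_j = f` against the AFFINE ANNIHILATOR `ψ = (τ−c_j)·(e₃ × X_j′)` of the model self operator — the rate column
`R_j` is affine along a straight filament (`…Clause13RRateColumnFloor.rateColumn_straight`), while the leading (local-induction) part of `DT` is,
on the straight constant-core model, `t × M_q[Y]` with the Taylor-remainder operator
`M_q[f](τ) = ∫ ((τ−σ)²+q)^{-3/2} (f τ − f σ − (τ−σ) f′σ) dσ = (2/q) f τ − (K_q ∗ f)(τ)`, `K_q(s) = (2q − s²)(s²+q)^{-5/2}`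
(B1 `selfTerm_straight`, B2 `taylorRemainderOp_eq`).  This file proves the exact annihilation behind that pairing:

* `integral_smoothingKernel_eq` — `∫ K_q = 2/q` (from B2 at `f ≡ 1`: `M_q[1] = 0`);
* `integral_mul_smoothingKernel_eq_zero` — `∫ s·K_q(s) ds = 0` (odd);
* `integral_affine_mul_smoothingKernel` — `∫ (a + bτ) K_q(τ−σ) dτ = (2/q)(a + bσ)`: affine functions are reproduced by `K_q ∗`;
* `integral_affine_mul_taylorRemainder_eq_zero` — **for `f ∈ C¹` with compact support and every affine weight,
  `∫ (a + bτ)·M_q[f](τ) dτ = 0`** (B2, Fubini over `ℝ²` — the integrand is dominated by two convolution integrands — and the two moments).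

So in the model currency the rate column (affine, coefficient `e₃ × t` of norm `≥ √(θ₀(2−θ₀))`) is `L²`-ORTHOGONAL to the range of the straight
self-induction operator on compactly supported variations: the transversality the rate row asserts, before transport/strain/partner corrections and
before the window cut-off that the clause-level proof must still pay for (census (m5); NOT done here).
Hand `leafhand-ns-filamentskeletonrs-3-g0` (LAND-ONLY); `--supports stmt-NavierStokesRegularity-23612 --as helper`.
HONEST FRAMING: one-dimensional calculus for the MODEL operator of a HYPOTHETICAL filament skeleton on the NEGATIVE side of a MODEL blow-up route;
nothing here bears on Navier–Stokes regularity or blow-up; STUB R is NOT proved here.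
-/

noncomputable section

open MeasureTheory Filter Topology Set
open Summit.NavierStokesRegularity.NavierStokesRegularity.Theorems.MatchedKernel
  (taylorRemainderOp_eq continuous_smoothingKernel integrable_smoothingKernel_mul integrable_mul_smoothingKernel
   abs_smoothingKernel_le abs_mul_smoothingKernel_le K3_le_inv_one_add_sq)

namespace Summit.NavierStokesRegularity.NavierStokesRegularity.Theorems.Clause13RAffineAnnihilator
set_option linter.dupNamespace false

/-! ## §1 Moments of the smoothing kernel `K_q(s) = (2q − s²)(s²+q)^{-5/2}` -/

/-- `K_q` is integrable (real form). [folklore] -/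
theorem integrable_smoothingKernel_real {q : ℝ} (hq : 0 < q) :
    Integrable (fun s : ℝ => (2 * q - s ^ 2) * ((s ^ 2 + q) ^ (5 / 2 : ℝ))⁻¹) := by
  have h := integrable_smoothingKernel_mul hq continuous_const (φ := fun _ => (1:ℝ)) (fun _ => by simp)
  simpa using h

/-- `K_q` is even. [folklore] -/
theorem smoothingKernel_neg {q : ℝ} (s : ℝ) :
    (2 * q - (-s) ^ 2) * (((-s) ^ 2 + q) ^ (5 / 2 : ℝ))⁻¹ = (2 * q - s ^ 2) * ((s ^ 2 + q) ^ (5 / 2 : ℝ))⁻¹ := by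
  rw [neg_sq]

/-- **`∫ K_q = 2/q`**: the Taylor-remainder operator kills constants (`M_q[1] = 0`), and B2 reads `0 = (2/q)·1 − ∫ K_q`. [folklore] -/
theorem integral_smoothingKernel_eq {q : ℝ} (hq : 0 < q) :
    ∫ s : ℝ, (2 * q - s ^ 2) * ((s ^ 2 + q) ^ (5 / 2 : ℝ))⁻¹ = 2 / q := by
  have h := taylorRemainderOp_eq hq (f := fun _ => (1:ℝ)) (B := 1) contDiff_const (fun _ => by simp) (fun _ => by simp) 0
  -- `h : ∫ K₃(0−σ)·(1 − 1 − (0−σ)·0) dσ = 2/q − ∫ σ, K_q(0 − σ)`; the left side is `0` and the kernel is even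
  norm_num [neg_sq] at h
  linarith

/-- **`∫ s·K_q(s) ds = 0`** (odd integrand, integrable first moment). [folklore] -/
theorem integral_mul_smoothingKernel_eq_zero (q : ℝ) :
    ∫ s : ℝ, s * ((2 * q - s ^ 2) * ((s ^ 2 + q) ^ (5 / 2 : ℝ))⁻¹) = 0 := by
  have h := integral_neg_eq_self (fun s : ℝ => s * ((2 * q - s ^ 2) * ((s ^ 2 + q) ^ (5 / 2 : ℝ))⁻¹)) volume
  have hodd : (fun s : ℝ => (-s) * ((2 * q - (-s) ^ 2) * (((-s) ^ 2 + q) ^ (5 / 2 : ℝ))⁻¹))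
      = fun s => -(s * ((2 * q - s ^ 2) * ((s ^ 2 + q) ^ (5 / 2 : ℝ))⁻¹)) := by
    funext s; rw [neg_sq]; ring
  rw [hodd, integral_neg] at h
  linarith

/-- **Affine functions are reproduced by `K_q ∗`**: `∫ (a + bτ)·K_q(τ − σ) dτ = (2/q)(a + bσ)`. [folklore] -/
theorem integral_affine_mul_smoothingKernel {q : ℝ} (hq : 0 < q) (a b σ : ℝ) :
    ∫ τ : ℝ, (a + b * τ) * ((2 * q - (τ - σ) ^ 2) * (((τ - σ) ^ 2 + q) ^ (5 / 2 : ℝ))⁻¹) = 2 / q * (a + b * σ) := by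
  set K : ℝ → ℝ := fun s => (2 * q - s ^ 2) * ((s ^ 2 + q) ^ (5 / 2 : ℝ))⁻¹ with hK
  have hKi : Integrable K := integrable_smoothingKernel_real hq
  have hsKi : Integrable (fun s : ℝ => s * K s) := integrable_mul_smoothingKernel hq
  -- substitute `τ = σ + s`
  have hsub : ∫ τ : ℝ, (a + b * τ) * K (τ - σ) = ∫ s : ℝ, (a + b * (s + σ)) * K s := by
    have h := integral_sub_right_eq_self (μ := volume) (fun s : ℝ => (a + b * (s + σ)) * K s) σ
    simp only [sub_add_cancel] at h
    exact h
  have hsplit : (fun s : ℝ => (a + b * (s + σ)) * K s) = fun s => (a + b * σ) * K s + b * (s * K s) := by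
    funext s; ring
  show ∫ τ : ℝ, (a + b * τ) * K (τ - σ) = 2 / q * (a + b * σ)
  rw [hsub, hsplit, integral_add (hKi.const_mul _) (hsKi.const_mul _), integral_const_mul, integral_const_mul,
    hK, integral_smoothingKernel_eq hq, integral_mul_smoothingKernel_eq_zero q]
  ring

/-! ## §2 The pairing of `M_q[f]` with an affine weight vanishes -/

/-- Integrability on `ℝ²` of the Fubini integrand `(τ, σ) ↦ (a + bτ)·K_q(τ−σ)·f(σ)` for continuous compactly supported `f`: it is
dominated by the sum of the two convolution integrands `(|a| + |b||σ|)|f σ|·|K_q(τ−σ)|` and `|b||f σ|·|(τ−σ)K_q(τ−σ)|`. [folklore] -/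
theorem integrable_affine_kernel_prod {q : ℝ} (hq : 0 < q) {f : ℝ → ℝ} (hfc : Continuous f) (hfs : HasCompactSupport f)
    (a b : ℝ) :
    Integrable (fun p : ℝ × ℝ => (a + b * p.1) * ((2 * q - (p.1 - p.2) ^ 2) * (((p.1 - p.2) ^ 2 + q) ^ (5 / 2 : ℝ))⁻¹) * f p.2)
      (volume.prod volume) := by
  set K : ℝ → ℝ := fun s => (2 * q - s ^ 2) * ((s ^ 2 + q) ^ (5 / 2 : ℝ))⁻¹ with hK
  have hKc : Continuous K := continuous_smoothingKernel hq
  have hKi : Integrable K := integrable_smoothingKernel_real hq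
  have hsKi : Integrable (fun s : ℝ => s * K s) := integrable_mul_smoothingKernel hq
  -- the two `σ`-weights, integrable by compact support
  have hg1 : Integrable (fun σ : ℝ => (|a| + |b| * |σ|) * |f σ|) := by
    refine Continuous.integrable_of_hasCompactSupport ?_ ?_
    · exact (continuous_const.add (continuous_const.mul continuous_abs)).mul hfc.abs
    · exact (hfs.norm).mul_left
  have hg2 : Integrable (fun σ : ℝ => |b| * |f σ|) := by
    refine Continuous.integrable_of_hasCompactSupport (continuous_const.mul hfc.abs) (hfs.norm).mul_left
  -- the two convolution integrands on `ℝ²`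
  have hc1 := hg1.convolution_integrand (ContinuousLinearMap.mul ℝ ℝ) hKi.norm (μ := volume) (ν := volume)
  have hc2 := hg2.convolution_integrand (ContinuousLinearMap.mul ℝ ℝ) hsKi.norm (μ := volume) (ν := volume)
  have hsum := hc1.add hc2
  refine hsum.mono' ?_ (Eventually.of_forall fun p => ?_)
  · exact (((continuous_const.add (continuous_const.mul continuous_fst)).mul
      (hKc.comp (continuous_fst.sub continuous_snd))).mul (hfc.comp continuous_snd)).aestronglyMeasurable
  · obtain ⟨τ, σ⟩ := p
    simp only [ContinuousLinearMap.mul_apply', Pi.add_apply, Real.norm_eq_abs]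
    have h1 : |a + b * τ| ≤ (|a| + |b| * |σ|) + |b| * |τ - σ| := by
      calc |a + b * τ| = |a + b * σ + b * (τ - σ)| := by ring_nf
        _ ≤ |a + b * σ| + |b * (τ - σ)| := abs_add_le _ _
        _ ≤ (|a| + |b * σ|) + |b * (τ - σ)| := by linarith [abs_add_le a (b * σ)]
        _ = (|a| + |b| * |σ|) + |b| * |τ - σ| := by rw [abs_mul, abs_mul]
    have hK0 : 0 ≤ |K (τ - σ)| := abs_nonneg _
    have hf0 : 0 ≤ |f σ| := abs_nonneg _
    have hsK := abs_mul (τ - σ) (K (τ - σ))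
    show |(a + b * τ) * K (τ - σ) * f σ| ≤ (|a| + |b| * |σ|) * |f σ| * |K (τ - σ)| + |b| * |f σ| * |(τ - σ) * K (τ - σ)|
    rw [abs_mul, abs_mul, hsK]
    calc |a + b * τ| * |K (τ - σ)| * |f σ|
        ≤ ((|a| + |b| * |σ|) + |b| * |τ - σ|) * |K (τ - σ)| * |f σ| := by gcongr
      _ = (|a| + |b| * |σ|) * |f σ| * |K (τ - σ)| + |b| * |f σ| * (|τ - σ| * |K (τ - σ)|) := by ring

/-- **THE EXACT AFFINE ANNIHILATOR OF THE MODEL SELF OPERATOR.**  For `f ∈ C¹(ℝ)` with compact support, `q > 0` and any affine weight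
`a + bτ`: `∫ (a + bτ) · (∫ ((τ−σ)²+q)^{-3/2} (f τ − f σ − (τ−σ) f′σ) dσ) dτ = 0`.
Proof: B2 gives `M_q[f] = (2/q) f − K_q ∗ f`; by Fubini and `integral_affine_mul_smoothingKernel` the pairing of `K_q ∗ f` with the affine
weight is `(2/q)∫(a + bσ) f σ dσ`, which cancels the first term. [folklore] -/
theorem integral_affine_mul_taylorRemainder_eq_zero {q : ℝ} (hq : 0 < q) {f : ℝ → ℝ} (hf : ContDiff ℝ 1 f)
    (hfs : HasCompactSupport f) (a b : ℝ) :
    ∫ τ : ℝ, (a + b * τ) * (∫ σ : ℝ, (((τ - σ) ^ 2 + q) ^ (3 / 2 : ℝ))⁻¹ * (f τ - f σ - (τ - σ) * deriv f σ)) = 0 := by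
  set K : ℝ → ℝ := fun s => (2 * q - s ^ 2) * ((s ^ 2 + q) ^ (5 / 2 : ℝ))⁻¹ with hK
  have hfc : Continuous f := hf.continuous
  -- bounds for `f`, `f′` (compact support)
  obtain ⟨B₁, hB₁⟩ := hfc.bounded_above_of_compact_support hfs
  have hf'c : Continuous (deriv f) := hf.continuous_deriv le_rfl
  obtain ⟨B₂, hB₂⟩ := hf'c.bounded_above_of_compact_support hfs.deriv
  set B := max B₁ B₂ with hBdef
  have hfb : ∀ x, |f x| ≤ B := fun x => by rw [← Real.norm_eq_abs]; exact (hB₁ x).trans (le_max_left _ _)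
  have hf'b : ∀ x, |deriv f x| ≤ B := fun x => by rw [← Real.norm_eq_abs]; exact (hB₂ x).trans (le_max_right _ _)
  -- B2 pointwise in `τ`
  have hB2 : ∀ τ : ℝ, ∫ σ : ℝ, (((τ - σ) ^ 2 + q) ^ (3 / 2 : ℝ))⁻¹ * (f τ - f σ - (τ - σ) * deriv f σ)
      = 2 / q * f τ - ∫ σ : ℝ, K (τ - σ) * f σ := fun τ => taylorRemainderOp_eq hq hf hfb hf'b τ
  simp_rw [hB2]
  -- the Fubini integrand and its consequences
  have hF := integrable_affine_kernel_prod hq hfc hfs a b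
  have hFl : Integrable (fun τ : ℝ => ∫ σ : ℝ, (a + b * τ) * K (τ - σ) * f σ) := hF.integral_prod_left
  have hψf : Integrable (fun τ : ℝ => (a + b * τ) * (2 / q * f τ)) := by
    refine Continuous.integrable_of_hasCompactSupport ((continuous_const.add (continuous_const.mul continuous_id)).mul
      (continuous_const.mul hfc)) ?_
    exact (hfs.mul_left (f := fun _ => 2 / q)).mul_left
  -- split the outer integral
  have hsplit : (fun τ : ℝ => (a + b * τ) * (2 / q * f τ - ∫ σ : ℝ, K (τ - σ) * f σ))
      = fun τ => (a + b * τ) * (2 / q * f τ) - ∫ σ : ℝ, (a + b * τ) * K (τ - σ) * f σ := by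
    funext τ
    rw [mul_sub, ← integral_const_mul]
    congr 1
    refine integral_congr_ae (Eventually.of_forall fun σ => ?_)
    simp only [hK]; ring
  rw [hsplit, integral_sub hψf hFl]
  -- swap the order of integration in the second term
  have hswap : ∫ τ : ℝ, ∫ σ : ℝ, (a + b * τ) * K (τ - σ) * f σ = ∫ σ : ℝ, ∫ τ : ℝ, (a + b * τ) * K (τ - σ) * f σ :=
    integral_integral_swap hF
  rw [hswap]
  have hinner : ∀ σ : ℝ, ∫ τ : ℝ, (a + b * τ) * K (τ - σ) * f σ = 2 / q * (a + b * σ) * f σ := by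
    intro σ
    rw [integral_mul_const]
    congr 1
    exact integral_affine_mul_smoothingKernel hq a b σ
  simp_rw [hinner]
  rw [sub_eq_zero]
  refine integral_congr_ae (Eventually.of_forall fun τ => ?_)
  simp only []
  ring

end Summit.NavierStokesRegularity.NavierStokesRegularity.Theorems.Clause13RAffineAnnihilator

end
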